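import Literature.NumberTheory.LFunctions.YoshidaWindowGramColumnData
import HarnessLib

/-!
# C∞ rung `R1E` (even sector) — DATA `PKVNT` part 1/1

Route context: Fourier–Galerkin / Schur-complement certificates of Weil positivity on a window ("format C", C∞ door `weilPositivityOn_of_cinf_pipeline`); supporting stmt-RiemannHypothesis-0098; seat rh-explicit-weil-2 (`cinfemit.py`/`emit_lean2.py`, HOME/rh-explicit-weil-2/gen17/EMITTER-PHASE2.md). Data / bookkeeping only; standard axioms; no RH claim.
-/

set_option autoImplicit false
-- `Summit.RiemannHypothesis.RiemannHypothesis.…` is the layout-mandated namespace (summit = problem name).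
set_option linter.dupNamespace false

namespace Summit.RiemannHypothesis.RiemannHypothesis.Theorems.WeilFormatC

open Literature.NumberTheory.LFunctions

namespace CinfR1E

/-- Packed rows part 1/1 of table `PKVNT` (word width 355, 4 words). -/
def PKVNT_P : List ℕ := [
  0x7fffffffffced5c5d020b4e9851a7ca833780f76636fe7aa1449edb84d1ebadd76952914e7cfaf5564e59a0530000000000000296971da69a7822fa15e3ee75852d9d544ad2160ec668c13f4c5dcc749380d82f6ed5756b925ffffffffffffffffdd1e98e5dc4d80e33815336249b7d1cb3c737e66e509e9731473e270c95ab37c24d8e8e1c00000000000000000001f3066a8877823a78c022cb18fda9a37277d758d22fa032afa61565fc7ade84800a52,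
  0x80000006e0989a4cad0773bbdde75114a45acb9b440f4dff4a5790080dffd2810522815adf0dcc68a641ab024ffffffffffa350c81b9fa5b8ba53b2c7ac7241254db48166324e2463a250a94cf2e350260a0168f7c210eee6e00000000000004e104963d4e0d440057bc3597ac50cd18431f9125c343dc26b348b9539139e179b5f2c8a9663ffffffffffffffffba3d31cbb89b01c6702a66c4936fa39678e6fccdca13d2e628e7c4e192b566f5fc3926c6,
  0x7ffefab44fcd50c15277646624bfc3d6e1b87377e81b5b8cf0da06be763eff6acb8c4e3567707beffeb0d4ccb0000000dc16d135bfca1aa85f0dba1cf2cd14422e4ce8c0a382b5d2f9ec775b41895513d12359b2105c54ac6dffffffffff46a190373f4b7174a7658f58e4824a9b6902cc649c48c744a15299e5c6a04c14027553d11addf1c0000000000000a5a5c769a69e08be8578fb9d614b675512b48583b19a304fd317731d24e03611ca0b47ff3b5,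
  0xa6c6f3a6b6671cb9a96760dfcbfd2ff57393d4a333f63860e38b3e967d6c454c65b3948ac051f7d7ad827e266fffdf5689f9aa182a4eec8cc497f87adc370e6efd036b719e1b40d7cec7dfed597189c6ad57b3f8bfc20d6af20000001b82626932b41dceef779d4452916b2e6d103d37fd295e402037ff4a04148a056b8a2dff4c72c5621ebfffffffffe76ae2e8105a74c28d3e5419bc07bb31b7f3d50a24f6dc268f5d6ebb4a948a730293a9fd125c01f]

end CinfR1E

end Summit.RiemannHypothesis.RiemannHypothesis.Theorems.WeilFormatC
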